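import Literature.AlgebraicGeometry.Motives.HodgeTensor
import HarnessLib

/-!
# Discharged fact: the dual Hodge filtration is separated

`Literature.AlgebraicGeometry.Motives.HodgeTensor` records as a named fact
(`Literature.HodgeStructure.exists_dualFiltration_eq_bot : Prop`) that for a pure `ℚ`-Hodge structure
`H` of weight `n` on a `ℚ`-vector space `V` (Hodge filtration `F` on `V_ℂ = ℂ ⊗[ℚ] V`), the dual
filtration `F^p V^∨ := (F^{1-p} V)^⊥` on `ℂ ⊗[ℚ] V^∨` (`H.dualFiltration p`, the annihilator of
`F^{1-p}` pulled back along the comparison map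
`dualBaseChange V : ℂ ⊗[ℚ] V^∨ →ₗ[ℂ] (ℂ ⊗[ℚ] V)^∨`) is separated: `F^p V^∨ = 0` for some `p`.
This file proves it (`Literature.AlgebraicGeometry.Motives.HodgeStructure.exists_dualFiltration_eq_bot_holds`), so the field
`exists_dualFiltration_eq_bot` of the hypothesis class `Literature.AlgebraicGeometry.Motives.HodgeTensorFacts` can be fed a proof.

In the source this is immediate: Deligne, *Théorie de Hodge II*, (1.1.6) defines the filtration
dual to `F` on the dual object `A°` by `F^n(A°) = (A/F^{1-n}(A))°`, and a filtration is finite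
(1.1.4) when `F^n(A) = A` and `F^m(A) = 0` for some `n`, `m`; the dual of a finite filtration is
visibly finite (`F^q(A) = A` gives `F^{1-q}(A°) = (A/A)° = 0`). The only content specific to the
formalization is that the dual filtration is placed on `ℂ ⊗[ℚ] V^∨` rather than on `(ℂ ⊗[ℚ] V)^∨`,
so that `F^{1-q} V^∨ = ker (dualBaseChange V)`; hence the fact is *equivalent* to the injectivity
of the comparison map `ℂ ⊗[ℚ] V^∨ → (ℂ ⊗[ℚ] V)^∨`, for every `ℚ`-vector space `V` (the fact
quantifies over all `V`, finite-dimensional or not).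

## Proof

`dualBaseChange_injective`: pick a `ℚ`-basis `(bᵢ)` of `ℂ` (`Module.Free.chooseBasis ℚ ℂ`) and
write `ξ ∈ ℂ ⊗[ℚ] V^∨` as `ξ = Σᵢ bᵢ ⊗ φᵢ` with finitely many `φᵢ ∈ V^∨`
(`TensorProduct.eq_repr_basis_left`). Then `dualBaseChange V ξ (1 ⊗ v) = Σᵢ φᵢ(v) • bᵢ`
(`dualBaseChange_tmul_tmul`), and if this vanishes for all `v`, linear independence of `(bᵢ)`
over `ℚ` gives `φᵢ(v) = 0` for all `i`, `v`, i.e. `ξ = 0`. Then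
`exists_dualFiltration_eq_bot_holds`: with `F^q = ⊤` (exhaustion of `F`),
`F^{1-q} V^∨ = comap (dualBaseChange V) ⊤^⊥ = ker (dualBaseChange V) = ⊥`.
No finite-dimensionality is used.

## References

* P. Deligne, *Théorie de Hodge. II*, Publ. Math. IHÉS 40 (1971), 5–57, §1.1: (1.1.4) (finite
  filtrations), (1.1.6) (the dual filtration `F^n(A°) = (A/F^{1-n}(A))°`), (1.1.7)
  (`Gr^n(A°) = Gr^{-n}(A)°`). [DeligneHodgeII1971]
-/

noncomputable section

open scoped TensorProduct

namespace Literature.AlgebraicGeometry.Motives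

namespace HodgeStructure

universe u

variable {V : Type u} [AddCommGroup V] [Module ℚ V] {n : ℤ}

/-- The comparison map `dualBaseChange V : ℂ ⊗[ℚ] V^∨ → (ℂ ⊗[ℚ] V)^∨`, `c ⊗ φ ↦ (d ⊗ v ↦ c d φ(v))`,
is injective for every `ℚ`-vector space `V` (no finiteness needed; it is moreover bijective for
`V` finite-dimensional, Mathlib's `IsBaseChange.dual`). Proof: write `ξ = Σᵢ bᵢ ⊗ φᵢ` along a
`ℚ`-basis `(bᵢ)` of `ℂ`; then `dualBaseChange V ξ (1 ⊗ v) = Σᵢ φᵢ(v) • bᵢ`, which vanishes for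
all `v` only if every `φᵢ` does. [folklore] -/
theorem dualBaseChange_injective : Function.Injective (dualBaseChange V) := by
  rw [injective_iff_map_eq_zero]
  intro x hx
  let ℬ := Module.Free.chooseBasis ℚ ℂ
  obtain ⟨c, rfl⟩ := TensorProduct.eq_repr_basis_left ℬ x
  suffices c = 0 by simp [this]
  ext i v
  have h := LinearMap.congr_fun hx ((1 : ℂ) ⊗ₜ[ℚ] v)
  simp only [Finsupp.sum, map_sum, LinearMap.coe_sum, Finset.sum_apply,
    dualBaseChange_tmul_tmul, mul_smul_one, LinearMap.zero_apply] at h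
  simp only [Finsupp.coe_zero, Pi.zero_apply, LinearMap.zero_apply]
  by_cases hi : i ∈ c.support
  · exact linearIndependent_iff'.1 ℬ.linearIndependent c.support (fun i => c i v) h i hi
  · simp [Finsupp.notMem_support_iff.1 hi]

/-- The kernel of the comparison map `ℂ ⊗[ℚ] V^∨ → (ℂ ⊗[ℚ] V)^∨` is trivial
(`dualBaseChange_injective`, restated for the lattice of subspaces). [folklore] -/
theorem ker_dualBaseChange : LinearMap.ker (dualBaseChange V) = ⊥ :=
  LinearMap.ker_eq_bot.2 dualBaseChange_injective

/-- If `F^q V_ℂ = V_ℂ` then the dual filtration vanishes in degree `1 - q`: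
`F^{1-q} V^∨ = (V_ℂ)^⊥ = 0` (Deligne, Hodge II, (1.1.6): `F^{1-q}(A°) = (A/F^q(A))° = (A/A)° = 0`;
in the formalization, `ker (dualBaseChange V) = 0`). [cite: DeligneHodgeII1971, 1.1.6] -/
theorem dualFiltration_eq_bot_of_F_eq_top (H : HodgeStructure V n) {q : ℤ} (hq : H.F q = ⊤) :
    H.dualFiltration (1 - q) = ⊥ := by
  rw [dualFiltration, show 1 - (1 - q) = q by ring, hq, Submodule.dualAnnihilator_top,
    Submodule.comap_bot, ker_dualBaseChange]

/-- **Discharge of the named fact `exists_dualFiltration_eq_bot`**: the dual filtration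
`F^p V^∨ = (F^{1-p} V)^⊥` of a pure `ℚ`-Hodge structure is separated, for every `ℚ`-vector space
`V` and every weight. The filtration dual (Deligne, *Théorie de Hodge II*, (1.1.6)) to a finite
filtration ((1.1.4)) is finite: if `F^q V_ℂ = V_ℂ` (exhaustion, `H.exists_F_eq_top`) then
`F^{1-q} V^∨ = 0` (`dualFiltration_eq_bot_of_F_eq_top`, via `dualBaseChange_injective`).
Users holding `(h : exists_dualFiltration_eq_bot)` / the field of `HodgeTensorFacts` are fed this
theorem. [cite: DeligneHodgeII1971, 1.1.4 and 1.1.6] -/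
theorem exists_dualFiltration_eq_bot_holds : exists_dualFiltration_eq_bot (V := V) (n := n) := by
  intro H
  obtain ⟨q, hq⟩ := H.exists_F_eq_top
  exact ⟨1 - q, H.dualFiltration_eq_bot_of_F_eq_top hq⟩

end HodgeStructure

end Literature.AlgebraicGeometry.Motives

end
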